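import Summits.QuantumFields.YangMills.Theorems.UnitScaleTiltFluctuationComparisonRegPrGlobalSlackKernelLegRefOwn
import HarnessLib

/-!
# `UnitScaleTiltFluctuationComparisonRegPrGlobalSlackKernelLegPerRun` — 3⁗χ AS FIVE SINGLE-CLAUSE, OWN-INDEXED ROWS: EVERY ROW SPEAKS ABOUT ONE RUN ON ITS OWN LATTICES
# (crux `FluctuationComparisonRegPrIntL`, stmt-QuantumFields-20520, skeleton v5kC, STUB 3⁗χ `stub_globalTwoRunSlackFamChi`; width seat ym-ust-20520-w1 g0, count-neutral helper)

WHY.  After `…KernelLegRef` (p582696: the two cross-run rows factored through reference objects) and `…KernelLegRefOwn` (p583370: the kernel / loop-variable closeness rows in each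
run's own indexing + the (M6) geometry), two rows of 3⁗χ's socket still carry a run-`(K+1)` clause INDEXED BY RUN `K` (the seventh-order residual row `RemainderSmallΦ` and (44)
`CfgDistΦ`, exactly as the rows of record are written).  This file finishes the per-run rewriting:

* §1 **`RemainderSmallOwnΦ D R b₀ p₀ κ C_R`** (run `K`'s rest at height `n`, level `1+j`, domain `Y ∈ Loc K (K−n) triv (1+j)` — ONE clause) and **`remainderSmallΦ_of_own`**
  (`LocMatched` + `TreeLenRefinedOn` + `0 ≤ κ, C_R` + the window letters for `θ ≥ 0` ⟹ the two-clause row of record: run `K+1`'s clause is its own clause at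
  `(K+1, n, j+1, refineSet Y)`, same level factor, larger tree length);
* §2 **`CfgDistOwnΦ D B dist b₀ p₀ C_s`** and **`cfgDistΦ_of_own`** (`LocMatched` + matched distances; the bounds coincide);
* §3 the canon instances `remainderSmallΦ_canonCore_of_own`, `cfgDistΦ_canonCore_of_own`;
* §4 the socket **`K1aLegRowsOwnChi L 𝔠 a₀ a₁ a`**: rates/constants/threshold, per family/coupling the reference objects `Ψ` (height-free) and `BR` (coherent) BEFORE the (α)
  hypothesis, then per inhabited χ-package a coherent `p` and `(Φ, e, B)` with FIVE SINGLE-CLAUSE ROWS — `KernelRefOwnΦ`, (43) `KernelLegPointwiseΦ`, `RemainderSmallOwnΦ … (residualRemCore …)`,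
  (44) `CfgDistOwnΦ`, `CfgRefOwnΦ` — each of the shape «∀ K, (a statement about run K's package, run K's lattices, run K's window)»; **`k1aLegRowsRefChi_of_OwnChi`**,
  `k1aLegRowsRChi_of_OwnChi`, and the capstone **`globalTwoRunSlackFamChi_of_k1aLegRowsOwnChi : … → ⟨3⁗χ TEXT VERBATIM⟩`**.
WHAT 3⁗χ NOW IS, BY NAME (for NODE O's v4 per-run record; F-g4-1 criterion = each row must follow from run K's displayed rows for EVERY admissible witness `p K`):
`K1aLegRowsOwnChi` — five rows, each a `∀ K`-statement about ONE run.  HONEST FRAMING: bookkeeping + geometry over hypothesis schemas; nothing of [Balaban1985UV3] / [King1986] is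
asserted; registry untouched; YM₃ on T³ is a rung, not the Clay problem / 𝕋⁴ / a mass gap.

References: T. Bałaban, CMP 102 (1985) 255–275 [Balaban1985UV3] ((24)–(25) p.262, (43)–(45) pp.266–267, (57) p.270); C. King, CMP 102 (1986) 649–677 [King1986] (Thm 3.4 (3.9)
p.656, Prop. 3.6 (3.56) p.662, Prop. 3.9 (3.71)–(3.74) p.665); CMP 109 (1987) 249–301 [Balaban1987RG1] ((0.1) p.251).
-/

set_option autoImplicit false

noncomputable section

open scoped BigOperators
open Finset
open Literature.MathematicalPhysics.QuantumFieldTheory.Balaban1983to89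
open Literature.MathematicalPhysics.QuantumFieldTheory.Balaban1983to89.T3ContinuumYM3Torus
open Literature.MathematicalPhysics.QuantumFieldTheory.Balaban1983to89.T3UnitScaleTilt
open Literature.MathematicalPhysics.QuantumFieldTheory.Balaban1983to89.T3LevelShift
open Literature.MathematicalPhysics.QuantumFieldTheory.Balaban1983to89.T3AlphaInputsAC
open Literature.MathematicalPhysics.QuantumFieldTheory.Balaban1983to89.T3AlphaPolymerSocket
open Literature.MathematicalPhysics.QuantumFieldTheory.Balaban1983to89.T3AlphaInputsACTwoRun
open Literature.MathematicalPhysics.QuantumFieldTheory.Balaban1983to89.T3AlphaInputsACTwoRunLevel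
open Literature.MathematicalPhysics.QuantumFieldTheory.Balaban1985CMP102
open Literature.MathematicalPhysics.QuantumFieldTheory.Balaban1985CMP102.Setting
open Summit.QuantumFields.Balaban3D.Carriers
open Summit.QuantumFields.Balaban3D.Proofs.Primitives
open Summit.QuantumFields.Balaban3D.Proofs.GroupModelLieC (lieC)
open Summit.QuantumFields.Balaban3D.Proofs.Representation33 (jet26)
open Summit.QuantumFields.YangMills.Theorems
open Summit.QuantumFields.YangMills.Theorems.GlobalSlackKernelMatching
open Summit.QuantumFields.YangMills.Theorems.GlobalSlackCanonicalPolymers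

namespace Summit.QuantumFields.YangMills.Theorems.GlobalSlackKernelLeg

/-! ## §1 The residual row, own-indexed -/

section Residual

variable {F : T3Family} {γ : ℝ}

/-- **THE OWN-INDEXED RESIDUAL ROW** (hypothesis schema, never asserted): on run `K`'s `θ(n)`-window, for every `j < K − n` and `Y ∈ Loc K (K−n) triv (1+j)`, run `K`'s rest satisfies
`|R K (K−n) j Y (V↑)| ≤ C_R·e^{−κ𝓛_K(1+j, Y)}·θ(n)⁷·x⁴`, `x = L^{−(K−n−1−j)}` — the first clause of `RemainderSmallΦ` alone: ONE run ((57) «overall power greater than six» for that run's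
expansion, (M1) at its old levels). [cite: Balaban1985UV3, (57) p.270, (43) p.266] -/
def RemainderSmallOwnΦ (D : AlphaDataT3 F γ) (R : RemFam F) (b₀ p₀ κ C_R : ℝ) : Prop :=
  ∀ (K n : ℕ) (h : n ≤ K), ∀ j : ℕ, j < K - n →
    ∀ V : GaugeField (F.P n) 0 (Matrix.specialUnitaryGroup (Fin 2) ℂ), PlaqSmall (θBal F.L γ b₀ p₀ n) V →
      ∀ Y ∈ D.Loc K (K - n) (D.triv K (K - n)) (1 + j),
        |R K (K - n) j Y (fieldShift (F.sitesPerDir_eq (m := F.m) (K := K) (j := K - n) (m' := F.m) (K' := n) (j' := 0) (by omega)) V)| ≤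
          C_R * Real.exp (-κ * D.treeLen K (1 + j) Y) * θBal F.L γ b₀ p₀ n ^ 7 * (((F.L : ℝ) ^ (K - n - 1 - j))⁻¹) ^ 4

/-- **THE OWN-INDEXED RESIDUAL ROW GIVES THE ROW OF RECORD**: `RemainderSmallOwnΦ … C_R → RemainderSmallΦ … C_R` — run `K+1`'s clause at `(K, n, j, Y)` is its own clause at
`(K+1, n, j+1, refineSet Y)` (`LocMatched`), with the same level factor and a tree length at least run `K`'s (`TreeLenRefinedOn`; `0 ≤ κ`, `0 ≤ C_R`; window letters for `θ ≥ 0`).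
[cite: Balaban1985UV3, (57) p.270; Balaban1987RG1, (0.1) p.251] -/
theorem remainderSmallΦ_of_own {D : AlphaDataT3 F γ} {R : RemFam F} {b₀ p₀ κ C_R : ℝ}
    (hLoc : LocMatched D) (hT : TreeLenRefinedOn D) (hκ : 0 ≤ κ) (hCR : 0 ≤ C_R) (hL : 1 ≤ F.L) (hγ : 0 < γ) (hγ1 : γ ≤ 1) (hb : 0 < b₀)
    (h : RemainderSmallOwnΦ D R b₀ p₀ κ C_R) : RemainderSmallΦ D R b₀ p₀ κ C_R := by
  intro K n hnK j hj V hV Y hY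
  refine ⟨h K n hnK j hj V hV Y hY, ?_⟩
  have hY' : refineSet F K Y ∈ D.Loc (K + 1) (K + 1 - n) (D.triv (K + 1) (K + 1 - n)) (1 + (j + 1)) := by
    have hmaps := (hLoc K n hnK (1 + j) (by omega) (by omega)).mapsTo (Finset.mem_coe.mpr hY)
    rw [show 1 + (j + 1) = 1 + j + 1 by ring]
    exact Finset.mem_coe.mp hmaps
  have hown := h (K + 1) n (by omega) (j + 1) (by omega) V hV (refineSet F K Y) hY'
  rw [show K + 1 - n - 1 - (j + 1) = K - n - 1 - j by omega] at hown
  refine hown.trans ?_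
  have hθ : 0 ≤ θBal F.L γ b₀ p₀ n := (T3MinimiserStabilityReduction.θBal_pos hL hγ hγ1 hb p₀ n).le
  have hexp : Real.exp (-κ * D.treeLen (K + 1) (1 + (j + 1)) (refineSet F K Y)) ≤ Real.exp (-κ * D.treeLen K (1 + j) Y) :=
    Real.exp_le_exp.mpr (by nlinarith [hT K (K - n) j Y hY])
  have h0 : 0 ≤ θBal F.L γ b₀ p₀ n ^ 7 * (((F.L : ℝ) ^ (K - n - 1 - j))⁻¹) ^ 4 := by positivity
  calc C_R * Real.exp (-κ * D.treeLen (K + 1) (1 + (j + 1)) (refineSet F K Y)) * θBal F.L γ b₀ p₀ n ^ 7 * (((F.L : ℝ) ^ (K - n - 1 - j))⁻¹) ^ 4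
      = (C_R * Real.exp (-κ * D.treeLen (K + 1) (1 + (j + 1)) (refineSet F K Y))) * (θBal F.L γ b₀ p₀ n ^ 7 * (((F.L : ℝ) ^ (K - n - 1 - j))⁻¹) ^ 4) := by ring
    _ ≤ (C_R * Real.exp (-κ * D.treeLen K (1 + j) Y)) * (θBal F.L γ b₀ p₀ n ^ 7 * (((F.L : ℝ) ^ (K - n - 1 - j))⁻¹) ^ 4) :=
        mul_le_mul_of_nonneg_right (mul_le_mul_of_nonneg_left hexp hCR) h0
    _ = _ := by ring

end Residual

/-! ## §2 The (44) row, own-indexed -/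

section Cfg

variable {𝕍 : Type} [NormedAddCommGroup 𝕍] [NormedSpace ℂ 𝕍] {F : T3Family} {γ : ℝ}

/-- **THE OWN-INDEXED (44) ROW IN DISTANCE FORM** (hypothesis schema, never asserted): on run `K`'s `θ(n)`-window and its own listed domains, leg by leg,
`‖B K (K−n) j Y (V↑) c‖ ≤ C_s·(1 + d(c))·θ(n)·x²` — the first clause of `CfgDistΦ` alone: ONE run. [cite: Balaban1985UV3, (44) p.267, (27)-(28) p.263] -/
def CfgDistOwnΦ (D : AlphaDataT3 F γ) (B : CfgFam 𝕍 F) (dist : LegDist F) (b₀ p₀ C_s : ℝ) : Prop :=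
  ∀ (K n : ℕ) (h : n ≤ K), ∀ j : ℕ, j < K - n →
    ∀ V : GaugeField (F.P n) 0 (Matrix.specialUnitaryGroup (Fin 2) ℂ), PlaqSmall (θBal F.L γ b₀ p₀ n) V →
      ∀ Y ∈ D.Loc K (K - n) (D.triv K (K - n)) (1 + j), ∀ c : PBond (F.P K) j,
        ‖B K (K - n) j Y (fieldShift (F.sitesPerDir_eq (m := F.m) (K := K) (j := K - n) (m' := F.m) (K' := n) (j' := 0) (by omega)) V) c‖ ≤
          C_s * (1 + dist K j Y c) * θBal F.L γ b₀ p₀ n * (((F.L : ℝ) ^ (K - n - 1 - j))⁻¹) ^ 2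

omit [NormedSpace ℂ 𝕍] in
/-- **THE OWN-INDEXED (44) ROW GIVES THE ROW OF RECORD**: `CfgDistOwnΦ … C_s → CfgDistΦ … C_s` (`LocMatched`; matched distances: run `K+1`'s own bound at
`(K+1, n, j+1, refineSet Y, matchBond c)` IS the record's second clause). [cite: Balaban1985UV3, (44) p.267; Balaban1987RG1, (0.1) p.251] -/
theorem cfgDistΦ_of_own {D : AlphaDataT3 F γ} {B : CfgFam 𝕍 F} {dist : LegDist F} {b₀ p₀ C_s : ℝ}
    (hLoc : LocMatched D) (hm : DistMatched dist) (h : CfgDistOwnΦ D B dist b₀ p₀ C_s) : CfgDistΦ D B dist b₀ p₀ C_s := by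
  intro K n hnK j hj V hV Y hY c
  refine ⟨h K n hnK j hj V hV Y hY c, ?_⟩
  have hY' : refineSet F K Y ∈ D.Loc (K + 1) (K + 1 - n) (D.triv (K + 1) (K + 1 - n)) (1 + (j + 1)) := by
    have hmaps := (hLoc K n hnK (1 + j) (by omega) (by omega)).mapsTo (Finset.mem_coe.mpr hY)
    rw [show 1 + (j + 1) = 1 + j + 1 by ring]
    exact Finset.mem_coe.mp hmaps
  have hown := h (K + 1) n (by omega) (j + 1) (by omega) V hV (refineSet F K Y) hY' (matchBond F K j c)
  rw [hm K j Y c, show K + 1 - n - 1 - (j + 1) = K - n - 1 - j by omega] at hown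
  exact hown

end Cfg

/-! ## §3 The geometry discharged at the χ-record's canonical polymerisation -/

section Canon

variable {F : T3Family} {𝔠 : AlphaConsts F.L (suGroupModel 2).N} {γ : ℝ} {hγ : 0 < γ} {hγ1 : γ ≤ (min 𝔠.gamma0 1) ^ 2}

/-- The own-indexed residual row gives `RemainderSmallΦ` at the χ-datum (decay `κ ≥ 0`, `C_R ≥ 0`; the record's window letters). [cite: Balaban1985UV3, (57) p.270] -/
theorem remainderSmallΦ_canonCore_of_own (p : ∀ K, AlphaInputsT3AC.PkgAtV3Chi F 𝔠 γ hγ hγ1 K) {R : RemFam F} {κ C_R : ℝ} (hκ : 0 ≤ κ) (hCR : 0 ≤ C_R)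
    (h : RemainderSmallOwnΦ (AlphaInputsT3AC.dataOfV3chi p (canonPolymerCore fun K => (p K).toCore)) R 𝔠.b₀ 𝔠.p₀ κ C_R) :
    RemainderSmallΦ (AlphaInputsT3AC.dataOfV3chi p (canonPolymerCore fun K => (p K).toCore)) R 𝔠.b₀ 𝔠.p₀ κ C_R :=
  remainderSmallΦ_of_own (locMatched_canonCore fun K => (p K).toCore) (treeLenRefinedOn_canonCore fun K => (p K).toCore) hκ hCR F.hL.2.le hγ
    (hγ1.trans (sq_min_one_le _ 𝔠.gamma0_pos)) 𝔠.b₀_pos h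

/-- The own-indexed (44) row gives `CfgDistΦ` at the χ-datum (canonical leg distance). [cite: Balaban1985UV3, (44) p.267] -/
theorem cfgDistΦ_canonCore_of_own (p : ∀ K, AlphaInputsT3AC.PkgAtV3Chi F 𝔠 γ hγ hγ1 K) {B : CfgFam ↥(lieC (suGroupModel 2)) F} {C_s : ℝ}
    (h : CfgDistOwnΦ (AlphaInputsT3AC.dataOfV3chi p (canonPolymerCore fun K => (p K).toCore)) B (canonLegDist F) 𝔠.b₀ 𝔠.p₀ C_s) :
    CfgDistΦ (AlphaInputsT3AC.dataOfV3chi p (canonPolymerCore fun K => (p K).toCore)) B (canonLegDist F) 𝔠.b₀ 𝔠.p₀ C_s :=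
  cfgDistΦ_of_own (locMatched_canonCore fun K => (p K).toCore) (canonLegDist_matched F) h

end Canon

/-! ## §4 The all-own socket and the registered text, by name -/

/-- **3⁗χ AS FIVE SINGLE-CLAUSE OWN-INDEXED ROWS** (hypothesis schema, never asserted): rates `0 < κ′ < κ₁`, nonnegative constants, a threshold `γB`; per family / coupling a
height-free reference chart family `Ψ` and a coherent reference configuration functional `BR` (BEFORE the (α) hypothesis); per inhabited χ-package a coherent `p : ∀ K, PkgAtV3Chi …`
and `(Φ, e, B)` with: `KernelRefOwnΦ` (each run's weighted flat kernels near `Ψ`'s, all point sets), (43) `KernelLegPointwiseΦ`, `RemainderSmallOwnΦ … (residualRemCore …)`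
((M1)+(57) for that run), (44) `CfgDistOwnΦ`, `CfgRefOwnΦ` (each run's loop variables near `BR`) — every row is «∀ K, a statement about run `K`'s package on run `K`'s own
lattices / window / localisation domains», so each is dischargeable from run `K`'s displayed record rows for EVERY admissible witness (F-g4-1).
[cite: King1986, Thm 3.4 (3.9) p.656, Prop. 3.6 (3.56) p.662, Prop. 3.9 (3.71)-(3.74) p.665; Balaban1985UV3, (43)-(45) pp.266-267, (57) p.270] -/
def K1aLegRowsOwnChi (L : ℕ) (𝔠 : AlphaConsts L (suGroupModel 2).N) (a₀ a₁ a : ℝ) : Prop :=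
  ∃ (κ' κ₁ C A C_R C_s C_B γB : ℝ), 0 < κ' ∧ κ' < κ₁ ∧ 0 ≤ C ∧ 0 ≤ A ∧ 0 ≤ C_R ∧ 0 ≤ C_s ∧ 0 ≤ C_B ∧ 0 < γB ∧
    ∀ (F : T3Family) (γ : ℝ) (hF : F.L = L) (hγ : 0 < γ), γ ≤ γB → ∀ (hγ1 : γ ≤ (min (hF ▸ 𝔠).gamma0 1) ^ 2),
      ∃ (Ψ : ChartFam ↥(lieC (suGroupModel 2)) F) (BR : CfgFam ↥(lieC (suGroupModel 2)) F), KerHeightFree Ψ ∧ RefCfgCoherent BR ∧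
        (AlphaInputsT3AC.OfV3ChiAt F (hF ▸ 𝔠) a₀ a₁ →
          ∃ (p : ∀ K, AlphaInputsT3AC.PkgAtV3Chi F (hF ▸ 𝔠) γ hγ hγ1 K), (∀ K, (p K).a₀ = a₀ ∧ (p K).a₁ = a₁) ∧
            ∃ (Φ : ChartFam ↥(lieC (suGroupModel 2)) F) (e : VacFam F) (B : CfgFam ↥(lieC (suGroupModel 2)) F),
              KernelRefOwnΦ (AlphaInputsT3AC.dataOfV3chi p (canonPolymerCore fun K => (p K).toCore)) Φ Ψ (canonLegDist F) κ' (hF ▸ 𝔠).κ a C ∧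
              KernelLegPointwiseΦ (AlphaInputsT3AC.dataOfV3chi p (canonPolymerCore fun K => (p K).toCore)) Φ (canonLegDist F) κ₁ (hF ▸ 𝔠).κ A ∧
              RemainderSmallOwnΦ (AlphaInputsT3AC.dataOfV3chi p (canonPolymerCore fun K => (p K).toCore)) (residualRemCore (fun K => (p K).toCore) Φ e B)
                (hF ▸ 𝔠).b₀ (hF ▸ 𝔠).p₀ (hF ▸ 𝔠).κ C_R ∧
              CfgDistOwnΦ (AlphaInputsT3AC.dataOfV3chi p (canonPolymerCore fun K => (p K).toCore)) B (canonLegDist F) (hF ▸ 𝔠).b₀ (hF ▸ 𝔠).p₀ C_s ∧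
              CfgRefOwnΦ (AlphaInputsT3AC.dataOfV3chi p (canonPolymerCore fun K => (p K).toCore)) B BR (canonLegDist F) (hF ▸ 𝔠).b₀ (hF ▸ 𝔠).p₀ a C_B)

/-- **THE ALL-OWN SOCKET GIVES THE PER-RUN SOCKET OF `…KernelLegRef`**: `K1aLegRowsOwnChi → K1aLegRowsRefChi` (same constants; the geometry of the canonical polymerisation —
`canonTreeLenCore_refineSet`, `locMatched_canonCore`, `canonLegDist_matched`/`_nonneg` — and the record's letters `κ ≥ κ₀ + 1 ≥ 0`, `b₀ > 0`, `γ ≤ 1`).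
[cite: Balaban1985UV3, (24)-(25) p.262, (43)-(45) pp.266-267, (57) p.270] -/
theorem k1aLegRowsRefChi_of_OwnChi {L : ℕ} {𝔠 : AlphaConsts L (suGroupModel 2).N} {a₀ a₁ a : ℝ} (ha : 0 ≤ a) (h : K1aLegRowsOwnChi L 𝔠 a₀ a₁ a) :
    K1aLegRowsRefChi L 𝔠 a₀ a₁ a := by
  obtain ⟨κ', κ₁, C, A, C_R, C_s, C_B, γB, hκ', hκ1, hC, hA, hCR, hCs, hCB, hγB, hall⟩ := h
  refine ⟨κ', κ₁, C, A, C_R, C_s, C_B, γB, hκ', hκ1, hC, hA, hCR, hCs, hCB, hγB, fun F γ hF hγ hγle hγ1 => ?_⟩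
  obtain ⟨Ψ, BR, hΨ, hBR, himp⟩ := hall F γ hF hγ hγle hγ1
  refine ⟨Ψ, BR, hΨ, hBR, fun hOf => ?_⟩
  obtain ⟨p, hp, Φ, e, B, hK, hP, hR, hS, hBC⟩ := himp hOf
  subst hF
  have hκ0 : 0 ≤ 𝔠.κ := by
    have h0 : 0 ≤ B12TreeDecay.kappa₀ (4 * 2 ^ 3) (2 * 3) := B12TreeDecay.kappa₀_nonneg (by norm_num) _
    linarith [𝔠.kappa_ge]
  exact ⟨p, hp, Φ, e, B, kernelRefΦ_canonCore_of_own p hκ0 hC ha hK, hP, remainderSmallΦ_canonCore_of_own p hκ0 hCR hR,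
    cfgDistΦ_canonCore_of_own p hS, cfgRefΦ_canonCore_of_own p hCB ha hBC⟩

/-- The all-own socket gives 3⁗χ's socket of record: `K1aLegRowsOwnChi → K1aLegRowsRChi` (`0 ≤ a`). [cite: King1986, Prop. 3.6 (3.56) p.662, Prop. 3.9 (3.71)-(3.74) p.665] -/
theorem k1aLegRowsRChi_of_OwnChi {L : ℕ} {𝔠 : AlphaConsts L (suGroupModel 2).N} {a₀ a₁ a : ℝ} (ha : 0 ≤ a) (h : K1aLegRowsOwnChi L 𝔠 a₀ a₁ a) :
    K1aLegRowsRChi L 𝔠 a₀ a₁ a :=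
  k1aLegRowsRChi_of_RefChi (k1aLegRowsRefChi_of_OwnChi ha h)

/-- **THE REGISTERED STUB 3⁗χ FROM THE ALL-OWN SOCKET, BY NAME** (`globalTwoRunSlackFamChi_of_k1aLegRowsRChi ∘ k1aLegRowsRChi_of_OwnChi`; the rate `0 < a` of the antecedent
supplies `0 ≤ a`): if for every odd `L ≥ 7`, every constants record and [7]-constants there is a rate exponent `0 < a < 1` with `K1aLegRowsOwnChi L 𝔠 a₀ a₁ a`, then the text of
`stub_globalTwoRunSlackFamChi` (skeleton v5kC of stmt-QuantumFields-20520) holds VERBATIM. [cite: King1986, Thm 3.4 (3.9) p.656, Prop. 3.6 (3.56) p.662; Balaban1985UV3, (43)-(47) pp.266-267, (57) p.270] -/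
theorem globalTwoRunSlackFamChi_of_k1aLegRowsOwnChi
    (h : ∀ (L : ℕ), Odd L → 7 ≤ L → ∀ (𝔠 : AlphaConsts L (suGroupModel 2).N) (a₀ a₁ : ℝ), 0 < a₀ → 0 < a₁ → 𝔠.B₃ * a₁ ≤ a₀ →
      ∃ a : ℝ, 0 < a ∧ a < 1 ∧ K1aLegRowsOwnChi L 𝔠 a₀ a₁ a) :
    ∀ (L : ℕ), Odd L → 7 ≤ L → ∀ (𝔠 : Summit.QuantumFields.Balaban3D.Proofs.Primitives.AlphaConsts L (Summit.QuantumFields.Balaban3D.Carriers.suGroupModel 2).N)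
      (a₀ a₁ : ℝ), 0 < a₀ → 0 < a₁ → 𝔠.B₃ * a₁ ≤ a₀ →
      ∃ a : ℝ, 0 < a ∧ ∃ γB : ℝ, 0 < γB ∧ ∀ (F : T3Family) (γ : ℝ) (hF : F.L = L) (hγ : 0 < γ), γ ≤ γB →
        ∀ (hγ1 : γ ≤ (min (hF ▸ 𝔠).gamma0 1) ^ 2),
          Summit.QuantumFields.YangMills.Theorems.AlphaInputsT3AC.OfV3ChiAt F (hF ▸ 𝔠) a₀ a₁ →
          ∃ (p : ∀ K, Summit.QuantumFields.YangMills.Theorems.AlphaInputsT3AC.PkgAtV3Chi F (hF ▸ 𝔠) γ hγ hγ1 K),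
            (∀ K, (p K).a₀ = a₀ ∧ (p K).a₁ = a₁) ∧
            ∃ (π : Summit.QuantumFields.YangMills.Theorems.AlphaInputsT3AC.PolymerT3 F) (σ : ℕ) (C : ℝ), 7 ≤ σ ∧ 0 ≤ C ∧
              Summit.QuantumFields.YangMills.Theorems.GlobalSlack.GlobalSupRateTSlack (Summit.QuantumFields.YangMills.Theorems.AlphaInputsT3AC.dataOfV3chi p π) (hF ▸ 𝔠).b₀ (hF ▸ 𝔠).p₀ a σ C :=
  globalTwoRunSlackFamChi_of_k1aLegRowsRChi fun L hLo h7 𝔠 a₀ a₁ ha0 ha1 hw => by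
    obtain ⟨a, ha, ha1', hc⟩ := h L hLo h7 𝔠 a₀ a₁ ha0 ha1 hw
    exact ⟨a, ha, ha1', k1aLegRowsRChi_of_OwnChi ha.le hc⟩

end Summit.QuantumFields.YangMills.Theorems.GlobalSlackKernelLeg

end
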